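import Literature.NumberTheory.GaloisRepresentations.KroneckerWeberTheorem
import Mathlib.NumberTheory.Cyclotomic.Basic
import HarnessLib

/-!
# Kronecker–Weber in the model `CyclotomicField m ℚ`

The tree proves the Kronecker–Weber theorem (`KroneckerWeber_holds`,
`KroneckerWeberTheorem.lean`) in the form: every finite-dimensional abelian Galois intermediate
field `L` of `ℚ̄/ℚ` lies in `ℚ(μ_m) = ℚ(ζ : ζ ^ m = 1) ⊆ ℚ̄` for some `m ≥ 1`
(Washington, *Introduction to Cyclotomic Fields*, Thm. 14.1). Consumers that work with an
ABSTRACT finite abelian extension `K/ℚ` and with Mathlib's model `CyclotomicField m ℚ` of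
`ℚ(ζ_m)` (Dirichlet characters as characters of `Gal(ℚ(ζ_m)/ℚ)`, Dedekind zeta functions of
abelian fields, Kato's twisted finiteness over abelian fields, …) need the equivalent phrasing

* `exists_algHom_cyclotomicField_of_isAbelianGalois` — **a finite abelian extension `K` of `ℚ`
  admits a `ℚ`-embedding `K →ₐ[ℚ] CyclotomicField m ℚ` for some `m ≥ 1`**:
  embed `K ↪ ℚ̄` (`IsAlgClosed.lift`), apply `KroneckerWeber_holds` to the image, observe that
  `ℚ(μ_m) ⊆ ℚ̄` is an `m`-th cyclotomic extension of `ℚ`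
  (`IntermediateField.isCyclotomicExtension_adjoin_of_exists_isPrimitiveRoot`) and transport to
  the model by `IsCyclotomicExtension.algEquiv`;
* `isAbelianGalois_of_algHom_cyclotomicField` — conversely a field with such an embedding is a
  finite abelian (Galois) extension of `ℚ` (Mathlib `IsAbelianGalois.of_algHom`), so the
  hypothesis is sharp;
* `exists_algHom_cyclotomicField_iff` — the equivalence.

No new definitions and no named facts: theorems only.

## References

* L. C. Washington, *Introduction to Cyclotomic Fields*, 2nd ed., GTM 83, Springer (1997),
  Ch. 14, Thm. 14.1. [Washington1997]
* D. A. Marcus, *Number Fields*, 2nd ed. (2018), Ch. 4, Ex. 29–36 (the proof formalised in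
  `KroneckerWeberTheorem.lean`). [Marcus2018]
-/

noncomputable section

namespace Literature.NumberTheory.GaloisRepresentations

open IntermediateField

/-- `IsAbelianGalois ℚ` is transported along `ℚ`-algebra isomorphisms. [folklore] -/
theorem isAbelianGalois_of_algEquiv {K K' : Type*} [Field K] [Field K'] [Algebra ℚ K]
    [Algebra ℚ K'] [h : IsAbelianGalois ℚ K] (e : K ≃ₐ[ℚ] K') : IsAbelianGalois ℚ K' :=
  IsAbelianGalois.of_algHom e.symm.toAlgHom

set_option backward.isDefEq.respectTransparency false in
/-- **Kronecker–Weber, `CyclotomicField` form.** Every finite abelian extension `K` of `ℚ`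
(finite-dimensional, Galois with commutative Galois group: Mathlib `IsAbelianGalois ℚ K`) admits
a `ℚ`-algebra embedding into the cyclotomic field `ℚ(ζ_m)` (`CyclotomicField m ℚ`) for some
`m ≥ 1`. Washington, Thm. 14.1: "Let `K/ℚ` be a finite abelian extension. Then `K ⊆ ℚ(ζₙ)` for
some `n`." Proof: embed `K ↪ ℚ̄`; its image `L₀` is a finite abelian subextension of `ℚ̄/ℚ`,
so `L₀ ≤ ℚ(μ_m)` by the tree's `KroneckerWeber_holds`; `ℚ(μ_m) ⊆ ℚ̄` is an `m`-th cyclotomic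
extension of `ℚ`, isomorphic to the model `CyclotomicField m ℚ`.
[cite: Washington1997, Ch. 14, Thm. 14.1] -/
theorem exists_algHom_cyclotomicField_of_isAbelianGalois (K : Type*) [Field K] [Algebra ℚ K]
    [FiniteDimensional ℚ K] [IsAbelianGalois ℚ K] :
    ∃ m : ℕ, 0 < m ∧ Nonempty (K →ₐ[ℚ] CyclotomicField m ℚ) := by
  classical
  -- embed `K ↪ ℚ̄`; its image `L₀` is a finite abelian subextension of `ℚ̄/ℚ`
  let Qb := AlgebraicClosure ℚ
  let f : K →ₐ[ℚ] Qb := IsAlgClosed.lift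
  let L₀ : IntermediateField ℚ Qb := f.fieldRange
  have eK : K ≃ₐ[ℚ] L₀ := f.equivFieldRange
  have hfd : FiniteDimensional ℚ L₀ := LinearEquiv.finiteDimensional eK.toLinearEquiv
  have hab : IsAbelianGalois ℚ L₀ := IsAbelianGalois.of_algHom eK.symm.toAlgHom
  -- Kronecker–Weber: `L₀ ⊆ ℚ(μ_m)`
  obtain ⟨m, hm, hle⟩ := KroneckerWeber_holds L₀ hfd hab
  haveI : NeZero m := ⟨hm.ne'⟩
  -- `C = ℚ(μ_m) ⊆ ℚ̄` is an `m`-th cyclotomic extension of `ℚ`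
  let C : IntermediateField ℚ Qb :=
    IntermediateField.adjoin ℚ {x : Qb | ∃ n ∈ ({m} : Set ℕ), n ≠ 0 ∧ x ^ n = 1}
  haveI hC : IsCyclotomicExtension {m} ℚ C := by
    refine IntermediateField.isCyclotomicExtension_adjoin_of_exists_isPrimitiveRoot {m} ℚ Qb ?_
    intro n hn hn0
    haveI := IsSepClosedOfCharZero.isCyclotomicExtension (K := Qb) {n}
    exact IsCyclotomicExtension.exists_isPrimitiveRoot Qb Qb hn hn0
  have hle' : L₀ ≤ C := by
    refine hle.trans (IntermediateField.adjoin.mono ℚ _ _ ?_)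
    intro x hx
    exact ⟨m, Set.mem_singleton m, hm.ne', hx⟩
  -- move to the model `CyclotomicField m ℚ`
  haveI : IsCyclotomicExtension {m} ℚ (CyclotomicField m ℚ) :=
    CyclotomicField.isCyclotomicExtension m ℚ
  let e₁ : C ≃ₐ[ℚ] CyclotomicField m ℚ := IsCyclotomicExtension.algEquiv {m} ℚ C _
  exact ⟨m, hm, ⟨e₁.toAlgHom.comp ((IntermediateField.inclusion hle').comp eK.toAlgHom)⟩⟩

/-- Variant of `exists_algHom_cyclotomicField_of_isAbelianGalois` with the modulus packaged as
`NeZero m` (the form in which `CyclotomicField m ℚ` carries its cyclotomic-extension instance).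
[cite: Washington1997, Ch. 14, Thm. 14.1] -/
theorem exists_neZero_algHom_cyclotomicField_of_isAbelianGalois (K : Type*) [Field K]
    [Algebra ℚ K] [FiniteDimensional ℚ K] [IsAbelianGalois ℚ K] :
    ∃ (m : ℕ) (_ : NeZero m), Nonempty (K →ₐ[ℚ] CyclotomicField m ℚ) := by
  obtain ⟨m, hm, h⟩ := exists_algHom_cyclotomicField_of_isAbelianGalois K
  exact ⟨m, ⟨hm.ne'⟩, h⟩

set_option backward.isDefEq.respectTransparency false in
/-- **Converse (sharpness of the hypothesis).** A field `K` with a `ℚ`-embedding into some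
`ℚ(ζ_m)`, `m ≥ 1`, is a finite abelian extension of `ℚ`: a subextension of the abelian
extension `ℚ(ζ_m)/ℚ` (Mathlib `IsCyclotomicExtension.isAbelianGalois`,
`IsAbelianGalois.of_algHom`) of finite degree. [folklore] -/
theorem isAbelianGalois_of_algHom_cyclotomicField {K : Type*} [Field K] [Algebra ℚ K] {m : ℕ}
    [NeZero m] (ι : K →ₐ[ℚ] CyclotomicField m ℚ) :
    IsAbelianGalois ℚ K ∧ FiniteDimensional ℚ K := by
  haveI : IsCyclotomicExtension {m} ℚ (CyclotomicField m ℚ) :=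
    CyclotomicField.isCyclotomicExtension m ℚ
  haveI : IsAbelianGalois ℚ (CyclotomicField m ℚ) :=
    IsCyclotomicExtension.isAbelianGalois {m} ℚ (CyclotomicField m ℚ)
  refine ⟨IsAbelianGalois.of_algHom ι, ?_⟩
  haveI : FiniteDimensional ℚ ι.fieldRange := inferInstance
  exact LinearEquiv.finiteDimensional ι.equivFieldRange.symm.toLinearEquiv

/-- **Kronecker–Weber as an equivalence in the `CyclotomicField` model**: a field extension
`K/ℚ` is finite abelian iff it embeds into some `ℚ(ζ_m)`, `m ≥ 1`.
[cite: Washington1997, Ch. 14, Thm. 14.1] -/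
theorem isAbelianGalois_and_finiteDimensional_iff (K : Type*) [Field K] [Algebra ℚ K] :
    (IsAbelianGalois ℚ K ∧ FiniteDimensional ℚ K) ↔
      ∃ m : ℕ, 0 < m ∧ Nonempty (K →ₐ[ℚ] CyclotomicField m ℚ) := by
  constructor
  · rintro ⟨h₁, h₂⟩
    exact exists_algHom_cyclotomicField_of_isAbelianGalois K
  · rintro ⟨m, hm, ⟨ι⟩⟩
    haveI : NeZero m := ⟨hm.ne'⟩
    exact isAbelianGalois_of_algHom_cyclotomicField ι

end Literature.NumberTheory.GaloisRepresentations

end
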